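import Summits.ResolutionOfSingularities.ResolutionOfSingularities.Theorems.WildConesCampaignW46HypersurfacesCharTwoHilbertWitness
import Summits.ResolutionOfSingularities.ResolutionOfSingularities.Theorems.WildConesCampaignW46HypersurfacesCharTwoNearLocus

/-!
# [OURS · L1 W4.6, rung (ii) at p = 2, HONEST SCOPE MARKER, n = 4] THE FIELD HYPOTHESES ARE SHARP: the
# order-2-cleaned fourfold double point `z² = u₀u₁ + u₂³ + u₂²u₃ + u₃³` is an isolated `D₄` state (`e = 2`, `h₂ = 1`,
# `μ = 4`) whose infinitely-near double points are the RATIONAL roots of `s³ + s²t + t³` — NONE over `𝔽₂`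
# (resolved by one blow-up although `μ = 4 > 2`), three over any field containing the roots

HONEST FRAMING. Everything here is OURS: an explicit computation in route WildCones' TYPED point-blow-up dynamics
(`Theorems/WildConesClassicalRegimesDefs.lean`), in the pattern of the seat's witnesses
`…HypersurfacesCharTwo{FourfoldMixed,HilbertWitness,FourfoldThreeTangents}.lean` (p507619, p517132, p560817), whose
Jacobian-ideal lemmas are reused (the gradient ideal `(u₁, u₀, u₂², u₃²)` is the same). NOTHING here is a statement
of the manuscript [Hironaka2017]; no FACT-LIST premise; AI review is weaker than expert review. Cell res-hironaka
(LADDER-RESOLUTION rung L, D-0089), slot W4.6, seat res-L1-s46-pv-4 (gen 7); host route `WildCones`, crux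
`ClassicalRegimes` (stmt-ResolutionOfSingularities-16884; proved).

WHY. Gen 7 weakened the field hypotheses of the census: at `h₂ ≥ 2` a near double point exists over EVERY field
(the null polar, `…NullPolarNear`), and over a SEPARABLY CLOSED field every corank-`≥ 2` double point has one, the
class `(2,1)` has exactly three, and an isolated double point (`n ≥ 3`) is resolved by one blow-up iff `μ ≤ 2`
(`…SepClosed`). This file shows that at `h₂ = 1` SOME hypothesis on the field is needed, in the slot's target class
(`n = 4`, order-2 cleaned): for `a = u₀u₁ + u₂³ + u₂²u₃ + u₃³` the kernel of the polar form is `{v₀ = v₁ = 0}`, the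
tangent cubic there is `w₂³ + w₂²w₃ + w₃³`, IRREDUCIBLE over `𝔽₂`; by the near-point criterion (p524988) the
infinitely-near double points are exactly the rational projective roots of this cubic. Over `𝔽₂` there is none: an
isolated double point with `μ = 4` and NO infinitely-near double point over its field of definition — both
`…HilbertTwoNearExists` (at `h₂ = 1`) and `⇒` of `…ResolvedInOneIffMuLeTwo` fail without closing the field
separably. (Over `𝔽₈ = 𝔽₂(θ)`, `θ³ + θ² + 1 = 0`, the three roots are rational and p555329 / `…SepClosed` give the
three free near points.)

WHAT IS PROVED (`κ` any field of characteristic `2` unless marked):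

* leaf lemmas for `u₀u₁ + u₂³ + u₂²u₃ + u₃³`: coefficients, `MultP`, `OrdP`, partials `(u₁, u₀, u₂², u₂² + u₃²)`,
  gradient ideal `=` that of `u₀u₁ + u₂²u₃ + u₂u₃²` (p507619), `Isol`, `μ ≤ 4`, polar matrix (kernel `{v₀ = v₁ = 0}`,
  exactly), tangent cubic `w₂³ + w₂²w₃ + w₃³`;
* `fourCubic_invariants` — `MultP`, `OrdP`, `Isol`, `e = 2`, `h₂ = 1`, `μ = 4`;
* `fourCubic_multP_step_iff` — **a chart/translation has a double successor iff its near vector `w` has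
  `w₀ = w₁ = 0` and `w₂³ + w₂²w₃ + w₃³ = 0`**;
* `fourCubic_no_near_point` — if `s³ + s²t + t³` has no non-trivial zero in `κ²`, NO chart/translation has a
  double successor; `fourfold_rationalCubic_witness_zmod_two` — **over `𝔽₂`: an order-2-cleaned isolated fourfold
  double state with `e = 2`, `h₂ = 1`, `μ = 4` and no double successor at all.**

References: [GreuelPfister2026] (context); [Hironaka2017] Th. 16.6 p.84 — role replaced only, under adjudication;
nothing of it is used.
-/

noncomputable section

-- single-problem summit: the doubled namespace component `ResolutionOfSingularities` is forced
set_option linter.dupNamespace false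

open scoped BigOperators Classical

open MvPowerSeries IsLocalRing

open Literature.AlgebraicGeometry.Resolution

namespace Summit.ResolutionOfSingularities.ResolutionOfSingularities.Theorems

namespace CampaignW46.HypersurfacesCharTwo

open WildCones WildCones.MuDropCharTwoOrdP ThreefoldsCharTwo

variable {κ : Type} [Field κ]

/-! ## The state `u₀u₁ + u₂³ + u₂²u₃ + u₃³`: coefficients, order, partials -/

/-- Coefficients of `X₀X₁ + X₂³ + X₂²X₃ + X₃³`. [folklore] -/
theorem coeff_fourCubic (A : Fin 4 →₀ ℕ) :
    coeff A ((X 0 * X 1 + X 2 ^ 3 + X 2 ^ 2 * X 3 + X 3 ^ 3 : MvPowerSeries (Fin 4) κ)) =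
      (if A = Finsupp.single 0 1 + Finsupp.single 1 1 then 1 else 0) +
        (if A = Finsupp.single 2 3 then 1 else 0) +
        (if A = Finsupp.single 2 2 + Finsupp.single 3 1 then 1 else 0) +
        (if A = Finsupp.single 3 3 then 1 else 0) := by
  rw [map_add, map_add, map_add, X_pow_eq, X_pow_eq, X_pow_eq, X_def, X_def, X_def, monomial_mul_monomial,
    monomial_mul_monomial, one_mul, coeff_monomial, coeff_monomial, coeff_monomial, coeff_monomial]

/-- The series has no monomial with all exponents even. [folklore] -/
theorem fourCubic_coeff_eq_zero_of_even (A : Fin 4 →₀ ℕ) (hA : ∀ j, 2 ∣ A j) :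
    coeff A ((X 0 * X 1 + X 2 ^ 3 + X 2 ^ 2 * X 3 + X 3 ^ 3 : MvPowerSeries (Fin 4) κ)) = 0 := by
  rw [coeff_fourCubic]
  have h0 : A ≠ Finsupp.single 0 1 + Finsupp.single 1 1 := by
    rintro rfl; have := hA 0; simp at this
  have h1 : A ≠ Finsupp.single 2 3 := by
    rintro rfl; have := hA 2; simp at this
  have h2 : A ≠ Finsupp.single 2 2 + Finsupp.single 3 1 := by
    rintro rfl; have := hA 3; simp at this
  have h3 : A ≠ Finsupp.single 3 3 := by
    rintro rfl; have := hA 3; simp at this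
  rw [if_neg h0, if_neg h1, if_neg h2, if_neg h3]
  simp

/-- The pair coefficient `[X₀X₁]` is `1`. [folklore] -/
theorem coeff_pair_fourCubic :
    coeff (Finsupp.single 0 1 + Finsupp.single 1 1)
      ((X 0 * X 1 + X 2 ^ 3 + X 2 ^ 2 * X 3 + X 3 ^ 3 : MvPowerSeries (Fin 4) κ)) = 1 := by
  rw [coeff_fourCubic, if_pos rfl]
  have h1 : (Finsupp.single 0 1 + Finsupp.single 1 1 : Fin 4 →₀ ℕ) ≠ Finsupp.single 2 3 := by
    intro h'; have := DFunLike.congr_fun h' 0; simp at this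
  have h2 : (Finsupp.single 0 1 + Finsupp.single 1 1 : Fin 4 →₀ ℕ) ≠
      Finsupp.single 2 2 + Finsupp.single 3 1 := by
    intro h'; have := DFunLike.congr_fun h' 0; simp at this
  have h3 : (Finsupp.single 0 1 + Finsupp.single 1 1 : Fin 4 →₀ ℕ) ≠ Finsupp.single 3 3 := by
    intro h'; have := DFunLike.congr_fun h' 0; simp at this
  rw [if_neg h1, if_neg h2, if_neg h3]
  simp

/-- [OURS · L1 W4.6] A state (`n = 4`) with cleaned series `u₀u₁ + u₂³ + u₂²u₃ + u₃³` is a double point.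
[folklore] -/
theorem multP_of_ser_eq_fourCubic {c : (Fin 4 → ℕ) → κ}
    (hc : ser 2 4 κ c = X 0 * X 1 + X 2 ^ 3 + X 2 ^ 2 * X 3 + X 3 ^ 3) : MultP 2 4 κ c := by
  rw [multP_iff_ser, hc]
  constructor
  · intro h
    have h1 := congrArg (coeff (Finsupp.single (0 : Fin 4) 1 + Finsupp.single 1 1)) h
    rw [coeff_pair_fourCubic, map_zero] at h1
    exact one_ne_zero h1
  · refine nat_le_order fun d hd => ?_
    rw [coeff_fourCubic]
    have h0 : d ≠ Finsupp.single 0 1 + Finsupp.single 1 1 := by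
      rintro rfl; simp only [map_add, Finsupp.degree_single] at hd; omega
    have h1 : d ≠ Finsupp.single 2 3 := by
      rintro rfl; simp only [Finsupp.degree_single] at hd; omega
    have h2 : d ≠ Finsupp.single 2 2 + Finsupp.single 3 1 := by
      rintro rfl; simp only [map_add, Finsupp.degree_single] at hd; omega
    have h3 : d ≠ Finsupp.single 3 3 := by
      rintro rfl; simp only [Finsupp.degree_single] at hd; omega
    rw [if_neg h0, if_neg h1, if_neg h2, if_neg h3]
    simp

/-- [OURS · L1 W4.6] … and order-2 cleaned (`u₀u₁`). [folklore] -/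
theorem ordP_of_ser_eq_fourCubic {c : (Fin 4 → ℕ) → κ}
    (hc : ser 2 4 κ c = X 0 * X 1 + X 2 ^ 3 + X 2 ^ 2 * X 3 + X 3 ^ 3) : OrdP 2 4 κ c := by
  rw [ordP_two_iff_exists_pair, hc]
  exact ⟨0, 1, by decide, by rw [coeff_pair_fourCubic]; exact one_ne_zero⟩

/-- In characteristic two: `∂₀ a = X₁`, `∂₁ a = X₀`, `∂₂ a = X₂²`, `∂₃ a = X₂² + X₃²`. [folklore] -/
theorem pderiv_fourCubic [CharP κ 2] (s : Fin 4) :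
    MvPowerSeries.pderiv s ((X 0 * X 1 + X 2 ^ 3 + X 2 ^ 2 * X 3 + X 3 ^ 3 : MvPowerSeries (Fin 4) κ)) =
      if s = 0 then X 1 else if s = 1 then X 0 else if s = 2 then X 2 ^ 2 else X 2 ^ 2 + X 3 ^ 2 := by
  have h2 : (2 : MvPowerSeries (Fin 4) κ) = 0 := by
    rw [← map_ofNat (C : κ →+* _) 2, CharTwo.two_eq_zero, map_zero]
  have h3 : (3 : MvPowerSeries (Fin 4) κ) = 1 := by
    rw [show (3 : MvPowerSeries (Fin 4) κ) = 2 + 1 by norm_num, h2, zero_add]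
  rw [map_add, map_add, map_add, Derivation.leibniz, Derivation.leibniz, Derivation.leibniz_pow,
    Derivation.leibniz_pow, Derivation.leibniz_pow, MvPowerSeries.pderiv_X, MvPowerSeries.pderiv_X,
    MvPowerSeries.pderiv_X, MvPowerSeries.pderiv_X]
  fin_cases s <;> simp [smul_eq_mul, h2, h3]

/-- The gradient ideal contains `X₀`, `X₁`, `X₂²`, `X₃²` (characteristic two). [folklore] -/
theorem mem_jac_fourCubic [CharP κ 2] :
    (X 0 : MvPowerSeries (Fin 4) κ) ∈ Ideal.span (Set.range fun s : Fin 4 =>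
        MvPowerSeries.pderiv s ((X 0 * X 1 + X 2 ^ 3 + X 2 ^ 2 * X 3 + X 3 ^ 3 : MvPowerSeries (Fin 4) κ))) ∧
    (X 1 : MvPowerSeries (Fin 4) κ) ∈ Ideal.span (Set.range fun s : Fin 4 =>
        MvPowerSeries.pderiv s ((X 0 * X 1 + X 2 ^ 3 + X 2 ^ 2 * X 3 + X 3 ^ 3 : MvPowerSeries (Fin 4) κ))) ∧
    (X 2 : MvPowerSeries (Fin 4) κ) ^ 2 ∈ Ideal.span (Set.range fun s : Fin 4 =>
        MvPowerSeries.pderiv s ((X 0 * X 1 + X 2 ^ 3 + X 2 ^ 2 * X 3 + X 3 ^ 3 : MvPowerSeries (Fin 4) κ))) ∧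
    (X 3 : MvPowerSeries (Fin 4) κ) ^ 2 ∈ Ideal.span (Set.range fun s : Fin 4 =>
        MvPowerSeries.pderiv s ((X 0 * X 1 + X 2 ^ 3 + X 2 ^ 2 * X 3 + X 3 ^ 3 : MvPowerSeries (Fin 4) κ))) := by
  have hX2 : (X 2 : MvPowerSeries (Fin 4) κ) ^ 2 ∈ Ideal.span (Set.range fun s : Fin 4 =>
      MvPowerSeries.pderiv s ((X 0 * X 1 + X 2 ^ 3 + X 2 ^ 2 * X 3 + X 3 ^ 3 : MvPowerSeries (Fin 4) κ))) := by
    refine Ideal.subset_span ⟨2, ?_⟩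
    simp only [pderiv_fourCubic]; simp
  refine ⟨?_, ?_, hX2, ?_⟩
  · refine Ideal.subset_span ⟨1, ?_⟩
    simp only [pderiv_fourCubic]; simp
  · refine Ideal.subset_span ⟨0, ?_⟩
    simp only [pderiv_fourCubic]; simp
  · have h23 : (X 2 : MvPowerSeries (Fin 4) κ) ^ 2 + X 3 ^ 2 ∈ Ideal.span (Set.range fun s : Fin 4 =>
        MvPowerSeries.pderiv s ((X 0 * X 1 + X 2 ^ 3 + X 2 ^ 2 * X 3 + X 3 ^ 3 : MvPowerSeries (Fin 4) κ))) := by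
      refine Ideal.subset_span ⟨3, ?_⟩
      simp only [pderiv_fourCubic]; simp
    have := Ideal.sub_mem _ h23 hX2
    rwa [add_sub_cancel_left] at this

/-- [OURS · L1 W4.6] **The gradient ideal of `u₀u₁ + u₂³ + u₂²u₃ + u₃³` IS that of `u₀u₁ + u₂²u₃ + u₂u₃²`**
(p507619), namely `(u₀, u₁, u₂², u₃²)` — so its Milnor algebra, `Isol` and `μ ≤ 4` transfer. [folklore] -/
theorem jac_fourCubic_eq_jac_fourMixed [CharP κ 2] :
    Ideal.span (Set.range fun s : Fin 4 =>
        MvPowerSeries.pderiv s ((X 0 * X 1 + X 2 ^ 3 + X 2 ^ 2 * X 3 + X 3 ^ 3 : MvPowerSeries (Fin 4) κ))) =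
      Ideal.span (Set.range fun s : Fin 4 =>
        MvPowerSeries.pderiv s ((X 0 * X 1 + X 2 ^ 2 * X 3 + X 2 * X 3 ^ 2 : MvPowerSeries (Fin 4) κ))) := by
  obtain ⟨hX0, hX1, hX2, hX3⟩ := mem_jac_fourMixed (κ := κ)
  obtain ⟨hY0, hY1, hY2, hY3⟩ := mem_jac_fourCubic (κ := κ)
  apply le_antisymm
  · rw [Ideal.span_le]
    rintro _ ⟨s, rfl⟩
    dsimp only
    rw [SetLike.mem_coe, pderiv_fourCubic]
    fin_cases s
    · simpa using hX1
    · simpa using hX0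
    · simpa using hX2
    · simpa using Ideal.add_mem _ hX2 hX3
  · rw [Ideal.span_le]
    rintro _ ⟨s, rfl⟩
    dsimp only
    rw [SetLike.mem_coe, pderiv_fourMixed]
    fin_cases s
    · simpa using hY1
    · simpa using hY0
    · simpa using hY3
    · simpa using hY2

/-- [OURS · L1 W4.6] **The state is ISOLATED** (`(∂a) ⊇ 𝔪³`). [folklore] -/
theorem isol_of_ser_eq_fourCubic [CharP κ 2] {c : (Fin 4 → ℕ) → κ}
    (hc : ser 2 4 κ c = X 0 * X 1 + X 2 ^ 3 + X 2 ^ 2 * X 3 + X 3 ^ 3) : Isol 2 4 κ c := by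
  rw [isol_iff_finite_pderiv, hc, jac_fourCubic_eq_jac_fourMixed]
  exact finite_quot_mono maximalIdeal_pow_three_le_jac_fourMixed
    (Literature.RingTheory.MvPowerSeries.Jets.finite_quotient_maximalIdeal_pow 3)

/-- [OURS · L1 W4.6] `μ ≤ 4` (the Milnor algebra is `κ⟦u⟧/(u₀, u₁, u₂², u₃²)`, p517132). [folklore] -/
theorem mu_fourCubic_le_four [CharP κ 2] {c : (Fin 4 → ℕ) → κ}
    (hc : ser 2 4 κ c = X 0 * X 1 + X 2 ^ 3 + X 2 ^ 2 * X 3 + X 3 ^ 3) : mu 2 4 κ c ≤ 4 := by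
  rw [mu_eq_finrank_pderiv, hc, jac_fourCubic_eq_jac_fourMixed]
  exact finrank_quot_jac_fourMixed_le_four

/-! ## The polar matrix: kernel `{v₀ = v₁ = 0}`, exactly -/

/-- The polar matrix of `u₀u₁ + u₂³ + u₂²u₃ + u₃³`: entry `1` at `(0,1)` and `(1,0)`, `0` elsewhere.
[folklore] -/
theorem polarMatrix_fourCubic_apply (s t : Fin 4) :
    polarMatrix ((X 0 * X 1 + X 2 ^ 3 + X 2 ^ 2 * X 3 + X 3 ^ 3 : MvPowerSeries (Fin 4) κ)) s t =
      if (s = 0 ∧ t = 1) ∨ (s = 1 ∧ t = 0) then 1 else 0 := by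
  simp only [polarMatrix, Matrix.of_apply]
  by_cases hst : s = t
  · subst hst
    rw [if_pos rfl, if_neg]
    rintro (⟨h0, h1⟩ | ⟨h1, h0⟩) <;> exact absurd (h0.symm.trans h1) (by decide)
  rw [if_neg hst, coeff_fourCubic]
  have h1 : (Finsupp.single s 1 + Finsupp.single t 1 : Fin 4 →₀ ℕ) ≠ Finsupp.single 2 3 := by
    intro h
    have hd := congrArg Finsupp.degree h
    simp only [map_add, Finsupp.degree_single] at hd
    omega
  have h2 : (Finsupp.single s 1 + Finsupp.single t 1 : Fin 4 →₀ ℕ) ≠ Finsupp.single 2 2 + Finsupp.single 3 1 := by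
    intro h
    have hd := congrArg Finsupp.degree h
    simp only [map_add, Finsupp.degree_single] at hd
    omega
  have h3 : (Finsupp.single s 1 + Finsupp.single t 1 : Fin 4 →₀ ℕ) ≠ Finsupp.single 3 3 := by
    intro h
    have hd := congrArg Finsupp.degree h
    simp only [map_add, Finsupp.degree_single] at hd
    omega
  rw [if_neg h1, if_neg h2, if_neg h3, add_zero, add_zero, add_zero]
  by_cases h01 : (s = 0 ∧ t = 1) ∨ (s = 1 ∧ t = 0)
  · rw [if_pos h01, if_pos]
    rcases h01 with ⟨rfl, rfl⟩ | ⟨rfl, rfl⟩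
    · rfl
    · rw [add_comm]
  · rw [if_neg h01, if_neg]
    intro h
    apply h01
    have hs := DFunLike.congr_fun h s
    have ht := DFunLike.congr_fun h t
    simp only [Finsupp.coe_add, Pi.add_apply, Finsupp.single_eq_same, Finsupp.single_apply] at hs ht
    fin_cases s <;> fin_cases t <;> simp_all

/-- [OURS · L1 W4.6] `w·P` for `u₀u₁ + u₂³ + u₂²u₃ + u₃³`: `(w·P)₀ = w₁`, `(w·P)₁ = w₀`, `(w·P)₂ = (w·P)₃ = 0`.
[folklore] -/
theorem vecMul_polarMatrix_fourCubic (w : Fin 4 → κ) (t : Fin 4) :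
    Matrix.vecMul w (polarMatrix ((X 0 * X 1 + X 2 ^ 3 + X 2 ^ 2 * X 3 + X 3 ^ 3 : MvPowerSeries (Fin 4) κ))) t =
      if t = 0 then w 1 else if t = 1 then w 0 else 0 := by
  rw [Matrix.vecMul, dotProduct, Fin.sum_univ_four, polarMatrix_fourCubic_apply, polarMatrix_fourCubic_apply,
    polarMatrix_fourCubic_apply, polarMatrix_fourCubic_apply]
  fin_cases t <;> simp

/-- [OURS · L1 W4.6] **The kernel of the polar matrix of `u₀u₁ + u₂³ + u₂²u₃ + u₃³` IS `{v₀ = v₁ = 0}`.**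
[folklore] -/
theorem vecMul_polarMatrix_fourCubic_eq_zero_iff (w : Fin 4 → κ) :
    Matrix.vecMul w (polarMatrix ((X 0 * X 1 + X 2 ^ 3 + X 2 ^ 2 * X 3 + X 3 ^ 3 : MvPowerSeries (Fin 4) κ))) = 0 ↔
      w 0 = 0 ∧ w 1 = 0 := by
  constructor
  · intro h
    have h0 := congrFun h 1
    have h1 := congrFun h 0
    rw [vecMul_polarMatrix_fourCubic, Pi.zero_apply] at h0 h1
    simp only [Fin.isValue, one_ne_zero, ↓reduceIte] at h0 h1
    exact ⟨h0, h1⟩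
  · rintro ⟨h0, h1⟩
    funext t
    rw [vecMul_polarMatrix_fourCubic, Pi.zero_apply, h0, h1]
    split_ifs <;> rfl

/-! ## The tangent cubic -/

/-- [OURS · L1 W4.6] The tangent cubic of `u₀u₁ + u₂³ + u₂²u₃ + u₃³` is `w₂³ + w₂²w₃ + w₃³`. [folklore] -/
theorem degForm_three_fourCubic (w : Fin 4 → κ) :
    degForm 3 ((X 0 * X 1 + X 2 ^ 3 + X 2 ^ 2 * X 3 + X 3 ^ 3 : MvPowerSeries (Fin 4) κ)) w =
      w 2 ^ 3 + w 2 ^ 2 * w 3 + w 3 ^ 3 := by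
  rw [X_pow_eq, X_pow_eq, X_pow_eq, X_def, X_def, X_def, monomial_mul_monomial, monomial_mul_monomial, one_mul,
    degForm_add, degForm_add, degForm_add,
    degForm_monomial_of_ne (by rw [map_add, Finsupp.degree_single, Finsupp.degree_single]; norm_num),
    degForm_monomial (by rw [Finsupp.degree_single]),
    degForm_monomial (by rw [map_add, Finsupp.degree_single, Finsupp.degree_single]),
    degForm_monomial (by rw [Finsupp.degree_single]), Fin.prod_univ_four, Fin.prod_univ_four, Fin.prod_univ_four]
  simp

/-! ## The invariants and the near points -/

/-- [OURS · L1 W4.6 rung (ii) at `p = 2`, `n = 4`; NOT a statement of the manuscript] **`u₀u₁ + u₂³ + u₂²u₃ + u₃³`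
is an order-2-cleaned isolated `D₄` double state**: `MultP`, `OrdP`, `Isol`, `e = 2`, `h₂ = 1`, `μ = 4`, over every
field of characteristic `2` (kernel plane `{v₀ = v₁ = 0}` of dimension two; `μ ≤ 4` from the gradient ideal
`(u₀,u₁,u₂²,u₃²)`; `μ ≥ h₂ + e + 1`, p517132). [folklore] -/
theorem fourCubic_invariants [CharP κ 2] {c : (Fin 4 → ℕ) → κ}
    (hc : ser 2 4 κ c = X 0 * X 1 + X 2 ^ 3 + X 2 ^ 2 * X 3 + X 3 ^ 3) :
    MultP 2 4 κ c ∧ OrdP 2 4 κ c ∧ Isol 2 4 κ c ∧ milnorEmbDim 2 4 κ c = 2 ∧ milnorHilbertTwo 2 4 κ c = 1 ∧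
      mu 2 4 κ c = 4 := by
  have hM := multP_of_ser_eq_fourCubic hc
  have hO := ordP_of_ser_eq_fourCubic hc
  have hI := isol_of_ser_eq_fourCubic hc
  -- `e = 2`: `e ≤ 2` by `OrdP`, `e ≥ 2` since `e₂, e₃` span a plane inside the kernel
  have hle : milnorEmbDim 2 4 κ c ≤ 2 := by
    have := (ordP_iff_milnorEmbDim_add_two_le hM).mp hO
    omega
  have hge : 2 ≤ milnorEmbDim 2 4 κ c := by
    set K := LinearMap.ker (polarMatrix (ser 2 4 κ c)).mulVecLin with hK
    have hfr : Module.finrank κ K = milnorEmbDim 2 4 κ c := by rw [hK, finrank_ker_polarMatrix hM]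
    have hmem : ∀ v : Fin 4 → κ, v 0 = 0 → v 1 = 0 → v ∈ K := by
      intro v h0 h1
      rw [hK, mem_ker_polarMatrix_iff, hc, vecMul_polarMatrix_fourCubic_eq_zero_iff]
      exact ⟨h0, h1⟩
    have h2K : (Pi.single 2 1 : Fin 4 → κ) ∈ K := hmem _ (by simp) (by simp)
    have h3K : (Pi.single 3 1 : Fin 4 → κ) ∈ K := hmem _ (by simp) (by simp)
    have h20 : (Pi.single 2 1 : Fin 4 → κ) ≠ 0 := fun h => by
      have := congrFun h 2; simp at this
    have hL : (κ ∙ (Pi.single 2 1 : Fin 4 → κ)) < K := by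
      refine lt_of_le_of_ne ((Submodule.span_singleton_le_iff_mem _ K).mpr h2K) (fun hEq => ?_)
      have h3L : (Pi.single 3 1 : Fin 4 → κ) ∈ (κ ∙ (Pi.single 2 1 : Fin 4 → κ)) := by rw [hEq]; exact h3K
      obtain ⟨r, hr⟩ := Submodule.mem_span_singleton.mp h3L
      have := congrFun hr 3
      simp at this
    haveI : FiniteDimensional κ K := FiniteDimensional.finiteDimensional_submodule K
    have hlt := Submodule.finrank_lt_finrank_of_lt hL
    rw [finrank_span_singleton h20] at hlt
    omega
  have he : milnorEmbDim 2 4 κ c = 2 := le_antisymm hle hge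
  obtain ⟨hh, hμ⟩ := milnorHilbertTwo_eq_one_of_mu_le_four hM hI he (mu_fourCubic_le_four hc)
  exact ⟨hM, hO, hI, he, hh, hμ⟩

/-- [OURS · L1 W4.6 rung (ii) at `p = 2`, `n = 4`; NOT a statement of the manuscript] **THE INFINITELY-NEAR DOUBLE
POINTS OF `u₀u₁ + u₂³ + u₂²u₃ + u₃³` ARE THE RATIONAL ROOTS OF `s³ + s²t + t³`**: a chart `i` and a translation
`τ` give a double successor iff the near vector `w = (τ with w_i = 1)` satisfies `w₀ = w₁ = 0` and
`w₂³ + w₂²w₃ + w₃³ = 0` (near-point criterion p524988 with the kernel and the cubic of this file). [folklore] -/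
theorem fourCubic_multP_step_iff [CharP κ 2] {c : (Fin 4 → ℕ) → κ}
    (hc : ser 2 4 κ c = X 0 * X 1 + X 2 ^ 3 + X 2 ^ 2 * X 3 + X 3 ^ 3) (i : Fin 4) (τ : Fin 4 → κ) :
    MultP 2 4 κ (step 2 4 κ i τ c) ↔
      Function.update τ i 1 0 = 0 ∧ Function.update τ i 1 1 = 0 ∧
        Function.update τ i 1 2 ^ 3 + Function.update τ i 1 2 ^ 2 * Function.update τ i 1 3 +
          Function.update τ i 1 3 ^ 3 = 0 := by
  obtain ⟨hM, -, hI, -⟩ := fourCubic_invariants hc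
  rw [hypersurface_multP_step_iff c i τ hM hI, hc, vecMul_polarMatrix_fourCubic_eq_zero_iff,
    degForm_three_fourCubic, and_assoc]

/-- [OURS · L1 W4.6 rung (ii) at `p = 2`, `n = 4`; NOT a statement of the manuscript] **NO RATIONAL ROOT, NO
INFINITELY-NEAR DOUBLE POINT**: if `s³ + s²t + t³ = 0` has only the trivial solution in `κ²` (e.g. `κ = 𝔽₂`, or
any field of characteristic `2` over which this cubic stays irreducible), then NO chart and translation of the
isolated `D₄` state `u₀u₁ + u₂³ + u₂²u₃ + u₃³` (`μ = 4`) gives a double successor. [folklore] -/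
theorem fourCubic_no_near_point [CharP κ 2] (hκ : ∀ s t : κ, s ^ 3 + s ^ 2 * t + t ^ 3 = 0 → s = 0 ∧ t = 0)
    {c : (Fin 4 → ℕ) → κ} (hc : ser 2 4 κ c = X 0 * X 1 + X 2 ^ 3 + X 2 ^ 2 * X 3 + X 3 ^ 3)
    (i : Fin 4) (τ : Fin 4 → κ) : ¬ MultP 2 4 κ (step 2 4 κ i τ c) := by
  intro hM'
  obtain ⟨h0, h1, hcub⟩ := (fourCubic_multP_step_iff hc i τ).mp hM'
  obtain ⟨h2, h3⟩ := hκ _ _ hcub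
  have hi : Function.update τ i 1 i = 1 := Function.update_self ..
  have hall : ∀ s : Fin 4, Function.update τ i 1 s = 0 := by
    intro s
    fin_cases s
    · exact h0
    · exact h1
    · exact h2
    · exact h3
  rw [hall i] at hi
  exact zero_ne_one hi

/-- [OURS · L1 W4.6 rung (ii) at `p = 2`, `n = 4`, HONEST SCOPE MARKER; NOT a statement of the manuscript] **THE
FIELD HYPOTHESES OF GEN 7 ARE SHARP: over `𝔽₂` an order-2-cleaned ISOLATED fourfold double state with `e = 2`,
`h₂ = 1`, `μ = 4` and NO infinitely-near double point at all** (`z² = u₀u₁ + u₂³ + u₂²u₃ + u₃³`; the kernel cubic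
`s³ + s²t + t³` is irreducible over `𝔽₂`). So `…HilbertTwoNearExists` does not extend to `h₂ = 1`, and `⇒` of
`…ResolvedInOneIffMuLeTwo` (`μ ≥ 3 ⇒` a near double point) needs the separable closedness: this point is resolved
by ONE blow-up over `𝔽₂` (and over `𝔽₄`), by FOUR over `𝔽₈`. [folklore] -/
theorem fourfold_rationalCubic_witness_zmod_two :
    ∃ c : (Fin 4 → ℕ) → ZMod 2, MultP 2 4 (ZMod 2) c ∧ OrdP 2 4 (ZMod 2) c ∧ Isol 2 4 (ZMod 2) c ∧
      milnorEmbDim 2 4 (ZMod 2) c = 2 ∧ milnorHilbertTwo 2 4 (ZMod 2) c = 1 ∧ mu 2 4 (ZMod 2) c = 4 ∧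
      ∀ (i : Fin 4) (τ : Fin 4 → ZMod 2), ¬ MultP 2 4 (ZMod 2) (step 2 4 (ZMod 2) i τ c) := by
  obtain ⟨c, hc⟩ := exists_ser_eq (X 0 * X 1 + X 2 ^ 3 + X 2 ^ 2 * X 3 + X 3 ^ 3 : MvPowerSeries (Fin 4) (ZMod 2))
    fourCubic_coeff_eq_zero_of_even
  obtain ⟨hM, hO, hI, he, hh, hμ⟩ := fourCubic_invariants hc
  exact ⟨c, hM, hO, hI, he, hh, hμ, fourCubic_no_near_point (by decide) hc⟩

end CampaignW46.HypersurfacesCharTwo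

end Summit.ResolutionOfSingularities.ResolutionOfSingularities.Theorems

end
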